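import Summits.Ventures.PercRepro.C025ProfilePLDThinColines

/-!
# EVERY ROW OF (Π) BY THE INJECTION (B, D) ↦ (B ∪ D, D), ON MATROIDS WITH ENOUGH INDEPENDENT DIRECTIONS (night-3 g32)

`proofs/NIGHT3-G32-MATCHING.md` §7.  The row `(q, u)` of (Π), `δ := u − q`, counts pairs `(B, D)` — `ρ(B) = q`, `D` a
`δ`-subset of a basis of `E ∖ B`, `ρ(E ∖ B) ≥ u` — against pairs `(S, Q)` — `ρ(S) = u`, `Q` a `q`-subset of a basis of `S`.
DIRECTIONS of a source `B` are the `δ`-subsets `D ⊆ E ∖ cl(B)` with `ρ(B ∪ D) = q + δ`; the map `(B, D) ↦ (B ∪ D, D)` sends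
them injectively to pairs (target, `δ`-set of coloops of the target), and a set of rank `u` has at most `u` coloops
(`PLDThin.card_coloops_le_eRk`), hence at most `C(u, δ) = C(u, q)` such sets.  So whenever every source has at least
`C(ρ(E ∖ B), δ)` directions — RICH DIRECTIONS — the row holds (`sum_choose_le_of_rich`, `profileIneq_of_rich`) and, through the
landed bridge, C-025 at `(p, q)` whenever the rows `q < u < p` are rich (`rls_of_rich`).  For `δ = 1` this is the thin-coline
theorem; every matroid of girth `> u` is rich at `(q, u − q)` (g18's rows), every paving matroid at every row below the rank.
No `def`, no `instance`, no notation.  Axioms: standard.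
-/

open scoped Matroid

namespace PercRepro

open Finset ThmH

namespace ThinRows

variable {α : Type} [DecidableEq α]

/-- Adding a `δ`-set to `B` raises the rank by at most `δ`, in `ℕ`. -/
theorem toNat_eRk_union_le (M : Matroid α) [M.Finite] (B D : Finset α) :
    (M.eRk ((B ∪ D : Finset α) : Set α)).toNat ≤ (M.eRk (B : Set α)).toNat + D.card := by
  have h := M.eRk_union_le_eRk_add_encard (B : Set α) (D : Set α)
  rw [← Finset.coe_union, Set.encard_coe_eq_coe_finsetCard] at h
  obtain ⟨n, hn⟩ : ∃ n : ℕ, M.eRk (B : Set α) = n := ⟨_, (ENat.coe_toNat (PLDThin.eRk_ne_top M _)).symm⟩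
  rw [hn] at h ⊢
  have h' : M.eRk ((B ∪ D : Finset α) : Set α) ≤ ((n + D.card : ℕ) : ℕ∞) := by rw [Nat.cast_add]; exact h
  have := ENat.toNat_le_toNat h' (ENat.coe_ne_top _)
  rw [ENat.toNat_coe] at this
  simpa using this

open scoped Classical in
/-- THE INJECTION `(B, D) ↦ (B ∪ D, D)`: with `δ ≥ 1`, if every source `B` (`ρ(B) = q`, `ρ(E ∖ B) ≥ q + δ`) has at least
`C(ρ(E ∖ B), δ)` directions — `δ`-subsets `D ⊆ E ∖ cl(B)` with `ρ(B ∪ D) = q + δ` — then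
`Σ_{ρ(B) = q, ρ(E∖B) ≥ q+δ} C(ρ(E ∖ B), δ) ≤ C(q+δ, δ)·#{S : ρ(S) = q + δ}`. -/
theorem sum_choose_le_of_rich (M : Matroid α) [M.Finite] (q δ : ℕ) (hδ : 1 ≤ δ)
    (hrich : ∀ B ∈ (gr M).powerset, (M.eRk (B : Set α)).toNat = q →
      q + δ ≤ (M.eRk ((gr M \ B : Finset α) : Set α)).toNat →
      ((M.eRk ((gr M \ B : Finset α) : Set α)).toNat).choose δ ≤
        ((((gr M).filter (fun d => d ∉ M.closure (B : Set α))).powersetCard δ).filter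
          (fun D => (M.eRk ((B ∪ D : Finset α) : Set α)).toNat = q + δ)).card) :
    (∑ B ∈ (gr M).powerset, (if (M.eRk (B : Set α)).toNat = q ∧
        q + δ ≤ (M.eRk ((gr M \ B : Finset α) : Set α)).toNat then
        ((M.eRk ((gr M \ B : Finset α) : Set α)).toNat).choose δ else 0)) ≤
      (q + δ).choose δ * ((gr M).powerset.filter (fun S : Finset α => (M.eRk (S : Set α)).toNat = q + δ)).card := by
  set A := (gr M).powerset.filter (fun B : Finset α => (M.eRk (B : Set α)).toNat = q ∧
    q + δ ≤ (M.eRk ((gr M \ B : Finset α) : Set α)).toNat) with hA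
  set dirs : Finset α → Finset (Finset α) := fun B =>
    (((gr M).filter (fun d => d ∉ M.closure (B : Set α))).powersetCard δ).filter
      (fun D => (M.eRk ((B ∪ D : Finset α) : Set α)).toNat = q + δ) with hdirs
  set Bset := (gr M).powerset.filter (fun S : Finset α => (M.eRk (S : Set α)).toNat = q + δ) with hB
  set col : Finset α → Finset α := fun S => S.filter (fun d =>
    (M.eRk ((S.erase d : Finset α) : Set α)).toNat < (M.eRk (S : Set α)).toNat) with hcol
  -- step 1: the left side is at most the number of pairs (B, D)
  have step1 : (∑ B ∈ (gr M).powerset, (if (M.eRk (B : Set α)).toNat = q ∧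
      q + δ ≤ (M.eRk ((gr M \ B : Finset α) : Set α)).toNat then
      ((M.eRk ((gr M \ B : Finset α) : Set α)).toNat).choose δ else 0)) ≤ ∑ B ∈ A, (dirs B).card := by
    rw [← Finset.sum_filter]
    apply Finset.sum_le_sum
    intro B hB'
    have hB'' := Finset.mem_filter.1 hB'
    exact hrich B hB''.1 hB''.2.1 hB''.2.2
  -- step 2: pairs (B, D) inject into pairs (S, D) with S a target and D a δ-set of coloops of S
  have step2 : ∑ B ∈ A, (dirs B).card ≤ ∑ S ∈ Bset, ((col S).powersetCard δ).card := by
    rw [← Finset.card_sigma]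
    have hinj : Set.InjOn (fun p : (Σ _ : Finset α, Finset α) => ((p.1 ∪ p.2 : Finset α), p.2))
        ((A.sigma dirs : Finset (Σ _ : Finset α, Finset α)) : Set (Σ _ : Finset α, Finset α)) := by
      intro p hp p' hp' hpq
      obtain ⟨B, D⟩ := p
      obtain ⟨B', D'⟩ := p'
      simp only [Finset.coe_sigma, Set.mem_sigma_iff, Finset.mem_coe] at hp hp'
      simp only [Prod.mk.injEq] at hpq
      obtain ⟨h1, rfl⟩ := hpq
      have hBE : (B : Set α) ⊆ M.E := by
        rw [← coe_gr M]; exact_mod_cast Finset.mem_powerset.1 (Finset.mem_filter.1 hp.1).1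
      have hBE' : (B' : Set α) ⊆ M.E := by
        rw [← coe_gr M]; exact_mod_cast Finset.mem_powerset.1 (Finset.mem_filter.1 hp'.1).1
      have hdis : Disjoint B D := by
        rw [Finset.disjoint_left]
        intro d hdB hdD
        have := (Finset.mem_powersetCard.1 (Finset.mem_filter.1 hp.2).1).1 hdD
        exact (Finset.mem_filter.1 this).2 (M.subset_closure _ hBE (by exact_mod_cast hdB))
      have hdis' : Disjoint B' D := by
        rw [Finset.disjoint_left]
        intro d hdB hdD
        have := (Finset.mem_powersetCard.1 (Finset.mem_filter.1 hp'.2).1).1 hdD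
        exact (Finset.mem_filter.1 this).2 (M.subset_closure _ hBE' (by exact_mod_cast hdB))
      have : B = B' := by
        rw [← Finset.union_sdiff_cancel_right hdis, h1, Finset.union_sdiff_cancel_right hdis']
      subst this
      rfl
    rw [← Finset.card_image_of_injOn hinj]
    refine (Finset.card_le_card ?_).trans ((Finset.card_biUnion_le).trans (Finset.sum_le_sum
      (fun S _ => Finset.card_image_le (f := fun D => (S, D)) (s := (col S).powersetCard δ))))
    intro x hx
    rw [Finset.mem_image] at hx
    obtain ⟨⟨B, D⟩, hp, rfl⟩ := hx
    rw [Finset.mem_sigma] at hp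
    obtain ⟨hBA, hDd⟩ := hp
    rw [hA, Finset.mem_filter, Finset.mem_powerset] at hBA
    rw [hdirs, Finset.mem_filter, Finset.mem_powersetCard] at hDd
    obtain ⟨hBg, hBr, _⟩ := hBA
    obtain ⟨⟨hDout, hDc⟩, hSr⟩ := hDd
    have hBE : (B : Set α) ⊆ M.E := by rw [← coe_gr M]; exact_mod_cast hBg
    have hDg : D ⊆ gr M := hDout.trans (Finset.filter_subset _ _)
    have hS : (B ∪ D : Finset α) ⊆ gr M := Finset.union_subset hBg hDg
    rw [Finset.mem_biUnion]
    refine ⟨B ∪ D, ?_, ?_⟩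
    · rw [hB, Finset.mem_filter, Finset.mem_powerset]; exact ⟨hS, hSr⟩
    · rw [Finset.mem_image]
      refine ⟨D, ?_, rfl⟩
      rw [Finset.mem_powersetCard]
      refine ⟨?_, hDc⟩
      intro d hd
      rw [hcol, Finset.mem_filter]
      refine ⟨Finset.mem_union_right _ hd, ?_⟩
      -- removing d ∈ D from B ∪ D leaves rank ≤ q + δ − 1
      have hsub : (B ∪ D).erase d ⊆ B ∪ (D.erase d) := by
        intro x hx
        rw [Finset.mem_erase, Finset.mem_union] at hx
        rw [Finset.mem_union, Finset.mem_erase]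
        rcases hx.2 with h | h
        · exact Or.inl h
        · exact Or.inr ⟨hx.1, h⟩
      have h1 : (M.eRk (((B ∪ D).erase d : Finset α) : Set α)).toNat ≤
          (M.eRk ((B ∪ D.erase d : Finset α) : Set α)).toNat :=
        ENat.toNat_le_toNat (M.eRk_mono (by exact_mod_cast hsub)) (PLDThin.eRk_ne_top M _)
      have h2 := toNat_eRk_union_le M B (D.erase d)
      rw [Finset.card_erase_of_mem hd, hDc, hBr] at h2
      rw [hSr]
      omega
  -- step 3: a target of rank q + δ has at most q + δ coloops, hence at most C(q+δ, δ) δ-sets of them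
  have step3 : ∑ S ∈ Bset, ((col S).powersetCard δ).card ≤ ∑ S ∈ Bset, (q + δ).choose δ := by
    apply Finset.sum_le_sum
    intro S hS
    rw [hB, Finset.mem_filter, Finset.mem_powerset] at hS
    rw [Finset.card_powersetCard]
    apply Nat.choose_le_choose
    exact (PLDThin.card_coloops_le_eRk M hS.1).trans (le_of_eq hS.2)
  rw [Finset.sum_const, smul_eq_mul, mul_comm] at step3
  exact step1.trans (step2.trans step3)

open scoped Classical in
/-- The profile price of a rank-`q` set at level `q + δ` is `C(ρ(E ∖ B), δ) / C(q + δ, q)` when `ρ(E ∖ B) ≥ q + δ`, else `0`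
(`Nat.choose_mul`). -/
theorem price_eq_rich (M : Matroid α) [M.Finite] (q δ : ℕ) (B : Finset α) :
    Profile.price M q (q + δ) B =
      if q + δ ≤ (M.eRk ((gr M \ B : Finset α) : Set α)).toNat then
        ((((M.eRk ((gr M \ B : Finset α) : Set α)).toNat).choose δ : ℕ) : ℚ) / (((q + δ).choose q : ℕ) : ℚ) else 0 := by
  unfold Profile.price
  set n := (M.eRk ((gr M \ B : Finset α) : Set α)).toNat with hn
  have hcond : (((q + δ : ℕ) : ℕ∞) ≤ M.eRk ((gr M \ B : Finset α) : Set α)) ↔ q + δ ≤ n := by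
    rw [← ENat.coe_toNat (PLDThin.eRk_ne_top M ((gr M \ B : Finset α) : Set α)), ← hn]
    exact Nat.cast_le
  by_cases h : q + δ ≤ n
  · rw [if_pos (hcond.2 h), if_pos h]
    have key : ((n + q).choose (q + δ) : ℚ) * ((q + δ).choose q : ℚ) = ((n + q).choose q : ℚ) * (n.choose δ : ℚ) := by
      have := Nat.choose_mul (n := n + q) (k := q + δ) (s := q) (by omega)
      rw [show n + q - q = n by omega, show q + δ - q = δ by omega] at this
      exact_mod_cast this
    have hC : ((n + q).choose q : ℚ) ≠ 0 := by
      exact_mod_cast (Nat.choose_pos (Nat.le_add_left q n)).ne'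
    have hq : (((q + δ).choose q : ℕ) : ℚ) ≠ 0 := by
      exact_mod_cast (Nat.choose_pos (Nat.le_add_right q δ)).ne'
    rw [div_eq_div_iff hC hq]
    linarith [key]
  · rw [if_neg (fun h' => h (hcond.1 h')), if_neg h]

open scoped Classical in
/-- THE ROW `(q, q + δ)` OF (Π) on every matroid rich at `(q, δ)`. -/
theorem profileIneq_of_rich (M : Matroid α) [M.Finite] (q δ : ℕ) (hδ : 1 ≤ δ)
    (hrich : ∀ B ∈ (gr M).powerset, (M.eRk (B : Set α)).toNat = q →
      q + δ ≤ (M.eRk ((gr M \ B : Finset α) : Set α)).toNat →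
      ((M.eRk ((gr M \ B : Finset α) : Set α)).toNat).choose δ ≤
        ((((gr M).filter (fun d => d ∉ M.closure (B : Set α))).powersetCard δ).filter
          (fun D => (M.eRk ((B ∪ D : Finset α) : Set α)).toNat = q + δ)).card) :
    Profile.ProfileIneq M q (q + δ) := by
  unfold Profile.ProfileIneq
  have hsum : (∑ B ∈ Profile.Rq M q, Profile.price M q (q + δ) B) =
      (1 / (((q + δ).choose q : ℕ) : ℚ)) * ((∑ B ∈ (gr M).powerset, (if (M.eRk (B : Set α)).toNat = q ∧
        q + δ ≤ (M.eRk ((gr M \ B : Finset α) : Set α)).toNat then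
        ((M.eRk ((gr M \ B : Finset α) : Set α)).toNat).choose δ else 0) : ℕ) : ℚ) := by
    rw [PLDThin.Rq_eq, Finset.sum_filter, Nat.cast_sum, Finset.mul_sum]
    apply Finset.sum_congr rfl
    intro B _
    rw [price_eq_rich M q δ B]
    by_cases ha : (M.eRk (B : Set α)).toNat = q
    · by_cases hb : q + δ ≤ (M.eRk ((gr M \ B : Finset α) : Set α)).toNat
      · rw [if_pos ha, if_pos hb, if_pos ⟨ha, hb⟩]; ring
      · rw [if_pos ha, if_neg hb, if_neg (fun h => hb h.2)]; simp
    · rw [if_neg ha, if_neg (fun h => ha h.1)]; simp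
  have hlev : ((Shadow.levelSet M (q + δ)).card : ℚ) =
      (((gr M).powerset.filter (fun S : Finset α => (M.eRk (S : Set α)).toNat = q + δ)).card : ℚ) := by
    rw [PLDThin.levelSet_eq]
  rw [hsum, hlev]
  have hpos : (0 : ℚ) < (((q + δ).choose q : ℕ) : ℚ) := by
    exact_mod_cast Nat.choose_pos (Nat.le_add_right q δ)
  have hmain := sum_choose_le_of_rich M q δ hδ hrich
  rw [← Nat.choose_symm_add] at hmain
  rw [one_div, inv_mul_le_iff₀ hpos]
  exact_mod_cast hmain

open scoped Classical in
/-- C-025 AT `(p, q)` on every matroid rich at every row `q < u < p`: `ThmN.RLS M p q` through the landed bridge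
`GirthRows.rls_of_profileIneq_rows`. -/
theorem rls_of_rich (M : Matroid α) [M.Finite] (p q : ℕ)
    (hrich : ∀ δ, 1 ≤ δ → q + δ < p → ∀ B ∈ (gr M).powerset, (M.eRk (B : Set α)).toNat = q →
      q + δ ≤ (M.eRk ((gr M \ B : Finset α) : Set α)).toNat →
      ((M.eRk ((gr M \ B : Finset α) : Set α)).toNat).choose δ ≤
        ((((gr M).filter (fun d => d ∉ M.closure (B : Set α))).powersetCard δ).filter
          (fun D => (M.eRk ((B ∪ D : Finset α) : Set α)).toNat = q + δ)).card) :
    ThmN.RLS M p q := by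
  apply GirthRows.rls_of_profileIneq_rows p q
  intro u hqu hup
  obtain ⟨δ, rfl⟩ : ∃ δ, u = q + δ := ⟨u - q, by omega⟩
  exact profileIneq_of_rich M q δ (by omega) (hrich δ (by omega) hup)

end ThinRows

end PercRepro
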